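import Literature.Analysis.SpecialFunctions.GegenbauerOrthogonality
import Literature.Analysis.SpecialFunctions.GegenbauerGenerating
import Mathlib.Analysis.SpecialFunctions.Trigonometric.Inverse
import HarnessLib

/-!
# The sharp sup bound `|C_n^{(a)}(s)| ≤ C_n^{(a)}(1)` on `[-1, 1]` for `a ≥ 0`

For a real parameter `a ≥ 0`, `n ∈ ℕ` and `|s| ≤ 1`, the explicit Gegenbauer sum
`gegenbauerSum a n s = C_n^{(a)}(s)` of `GegenbauerExplicitODE.lean` satisfies the classical sharp
bound `|C_n^{(a)}(s)| ≤ C_n^{(a)}(1)` (Andrews–Askey–Roy (6.4.11), DLMF 18.14.4).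

Proof (AAR's: the Fourier form has nonnegative coefficients). Write `s = cos θ`,
`θ = arccos s`, and put `u = e^{iθ}`, `v = e^{-iθ}` in `ℂ`, so that `u + v = 2s`, `uv = 1`.
The tree already knows `C_n^{(a)}(s) = P^a_n(2s, 1)` (`gegenbauerSum_eq_gegenbauerHom`), that the
bivariate form commutes with `algebraMap ℝ ℂ` (`gegenbauerHom_algebraMap`), and the Fourier form
`P^a_n(u + v, uv) = Σ_{k+l=n} a_k a_l u^k v^l` (`gegenbauerFourier_eq_hom`) with `a_k = (a)_k/k! ≥ 0`
(`gegenbauerA_nonneg`).  Hence `|C_n^{(a)}(s)| = ‖Σ a_k a_l u^k v^l‖ ≤ Σ a_k a_l`, and the same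
identity at `u = v = 1` shows `Σ_{k+l=n} a_k a_l = P^a_n(2, 1) = C_n^{(a)}(1)`.

Everything is proved; no definitions, no named facts.  (Used by the sharp geometric tails of the
typed zonal heat series of `S⁴`, `Literature.Geometry.Riemannian.SphericalZonalSharpTail`.)

## References
* G. E. Andrews, R. Askey, R. Roy, *Special Functions*, CUP 1999, §6.4, (6.4.11).
  [AndrewsAskeyRoy1999]
* NIST DLMF 18.14.4.
-/

noncomputable section

open Finset
open scoped Nat

namespace Literature.Analysis.SpecialFunctions

/-- `C_n^{(a)}(1) = Σ_{k+l=n} a_k(a) a_l(a)`: the value at `1` is the sum of the Fourier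
coefficients (the Fourier form at `u = v = 1`). [cite: AndrewsAskeyRoy1999, (6.4.11)] -/
theorem gegenbauerSum_at_one_eq_sum_antidiagonal (a : ℝ) (n : ℕ) :
    gegenbauerSum a n 1 = ∑ x ∈ antidiagonal n, gegenbauerA a x.1 * gegenbauerA a x.2 := by
  have h := gegenbauerFourier_eq_hom a (1 : ℝ) (1 : ℝ) n
  rw [one_mul, one_add_one_eq_two] at h
  rw [gegenbauerSum_eq_gegenbauerHom, mul_one, ← h]
  simp [gegenbauerFourier]

/-- The complexified Gegenbauer sum at `s = cos θ` is the Fourier form at `e^{± iθ}`: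
`C_n^{(a)}(cos θ) = Σ_{k+l=n} a_k a_l e^{ikθ} e^{-ilθ}`. [cite: AndrewsAskeyRoy1999, (6.4.11)] -/
theorem ofReal_gegenbauerSum_cos_eq_gegenbauerFourier (a : ℝ) (n : ℕ) (θ : ℝ) :
    ((gegenbauerSum a n (Real.cos θ) : ℝ) : ℂ) =
      gegenbauerFourier a n (Complex.exp ((θ : ℂ) * Complex.I))
        (Complex.exp (-(θ : ℂ) * Complex.I)) := by
  have huv : Complex.exp ((θ : ℂ) * Complex.I) * Complex.exp (-(θ : ℂ) * Complex.I) =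
      ((1 : ℝ) : ℂ) := by
    rw [← Complex.exp_add, Complex.ofReal_one,
      show (θ : ℂ) * Complex.I + -(θ : ℂ) * Complex.I = 0 by ring, Complex.exp_zero]
  have hupv : Complex.exp ((θ : ℂ) * Complex.I) + Complex.exp (-(θ : ℂ) * Complex.I) =
      ((2 * Real.cos θ : ℝ) : ℂ) := by
    rw [← Complex.two_cos, ← Complex.ofReal_cos]
    push_cast
    ring
  rw [gegenbauerFourier_eq_hom, hupv, huv, gegenbauerSum_eq_gegenbauerHom]
  exact (gegenbauerHom_algebraMap (A := ℂ) a n (2 * Real.cos θ) 1).symm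

/-- **The sharp sup bound** `|C_n^{(a)}(s)| ≤ C_n^{(a)}(1)` for `a ≥ 0`, `|s| ≤ 1`
(AAR (6.4.11): the Fourier coefficients `a_k a_l` of `C_n^{(a)}(cos θ)` are nonnegative, so the
modulus is largest at `θ = 0`; DLMF 18.14.4). [cite: AndrewsAskeyRoy1999, (6.4.11)] -/
theorem abs_gegenbauerSum_le_gegenbauerSum_one {a : ℝ} (ha : 0 ≤ a) (n : ℕ) {s : ℝ}
    (hs : |s| ≤ 1) : |gegenbauerSum a n s| ≤ gegenbauerSum a n 1 := by
  obtain ⟨hs1, hs2⟩ := abs_le.1 hs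
  set θ : ℝ := Real.arccos s with hθ
  have hcos : Real.cos θ = s := Real.cos_arccos hs1 hs2
  have hu1 : ‖Complex.exp ((θ : ℂ) * Complex.I)‖ = 1 := Complex.norm_exp_ofReal_mul_I θ
  have hv1 : ‖Complex.exp (-(θ : ℂ) * Complex.I)‖ = 1 := by
    rw [← Complex.ofReal_neg]
    exact Complex.norm_exp_ofReal_mul_I (-θ)
  rw [← Real.norm_eq_abs, ← Complex.norm_real, ← hcos,
    ofReal_gegenbauerSum_cos_eq_gegenbauerFourier, gegenbauerSum_at_one_eq_sum_antidiagonal,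
    gegenbauerFourier]
  refine (norm_sum_le _ _).trans (Finset.sum_le_sum fun x _ => ?_)
  rw [norm_smul, norm_mul, norm_mul, norm_pow, norm_pow, hu1, hv1, one_pow, one_pow, mul_one,
    mul_one, Real.norm_eq_abs, Real.norm_eq_abs, abs_of_nonneg (gegenbauerA_nonneg ha _),
    abs_of_nonneg (gegenbauerA_nonneg ha _)]

end Literature.Analysis.SpecialFunctions

end
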